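import Literature.AlgebraicGeometry.Resolution.BenitoVillamayor2013HOrd
import HarnessLib

/-!
# Benito–Villamayor's STRONG MONOMIAL CASE at coefficient level (BV 2013 Def. 7.10, with Cor. 7.3, Thm. 7.11 (i),
# Cor. 7.14 read-outs) — the `δ_BV = 0` test for pure heads

Topic: `Literature/AlgebraicGeometry/Resolution`; third file of the coefficient-level rendering of
A. Benito, O. E. Villamayor U., *Monoidal transforms and invariants of singularities in positive characteristic*,
Compositio Math. **149** (2013) 1267–1311 = arXiv:1004.1803v2 [BenitoVillamayoru2013] (held text `paper:arxiv-1004.1803`;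
locators «chunk pNNNN Lk» = line k of the store file), after `BenitoVillamayor2013Cleaning.lean` (§5) and
`BenitoVillamayor2013HOrd.lean` (H-ord = the greatest translate slope). Conventions VERBATIM from those files: a local
ring `S` for `𝒪_{V^{(d-1)}, β_r(x)}`, a monic `f ∈ S[X]` of degree `q = pᵉ` for the `p`-presentation, `ρ : ℚ` for
`ord((ℛ_{𝒢,β})_r)(β_r(x))`, and NOW ALSO `t : ℚ` for `ord(𝓜_r W^s)(β_r(x)) = (Σ_{i ∈ Λ_x} h_i)/s`, the order at the
point of the TIGHT MONOMIAL ALGEBRA `𝓜_r W^s = 𝒪[I(H_1)^{h_1}⋯I(H_r)^{h_r}W^s]` of §7.4 (chunk p0022 L44–L53: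
«`q_{H_i} := h_i/s = v-ord^{(d-1)}(𝒢_{i-1})(ξ_{C_i}) − 1`»); like `ρ`, `t` is carried as a parameter because the
elimination / monomial algebras are not objects of the tree.

## What is typed
* `BV2013.IsStrongMonomialAt q f ρ t` — **Def. 7.10** (chunk p0023 L22–L26): «`𝒢_r` is said to be within the strong
  monomial case at a closed point `x ∈ Sing(𝒢_r)` if `v-ord^{(d-1)}(𝒢_r)(x) = ord(𝓜_r W^s)(x)`», at coefficient level:
  `t` IS the H-ord of the presentation (the H-ord being `v-ord^{(d-1)}(𝒢_r)(x)` for a well-adapted presentation,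
  Cor. 7.3, chunk p0022 L27–L33).
* PROVED read-outs: `isStrongMonomialAt_iff_eq` (given the H-ord `v`, strong ⟺ `v = t` — well-definedness, Cor. 7.3);
  `IsStrongMonomialAt.le` (`t ≤ ρ`, the right half of the sandwich `ord 𝓜_r ≤ H-ord ≤ ord ℛ`, arXiv:1103.3464
  Thm. 3.3); `isStrongMonomialAt_of_isCaseA` (Thm. 7.11, last sentence, chunk p0023 L30–L40: condition (i)
  `(ℛ_{𝒢,β})_r = 𝓜_r W^s`, i.e. `ρ = t`, holds iff `v-ord = ord ℛ`; coefficient form: case A) of §5.1 with `ρ = t`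
  gives the strong monomial case); and the CALIBRATION `isStrongMonomialAt_X_pow_add_C_iff` for PURE heads
  `z^{pᵉ} + a`, `ν(a) = m`, `pᵉ ∤ m`, `m/pᵉ < ρ`: strong monomial case at the point ⟺ `t = m/pᵉ` (from
  `isHOrd_X_pow_add_C_of_not_dvd`), the decidable «`δ_BV := H-ord − ord 𝓜 = 0`» test the campaign `res-hironaka`'s
  rescue bed asks for on its `z^{pᵉ} + F` calibration rows (column proposal C-BV-δ, OURS).
* NOT typed here (need the elimination algebra as an object): Thm. 7.11 (ii) («`𝒪[a_{pᵉ}W^{pᵉ}]` and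
  `𝒪[𝓜_r W^s]` have the same integral closure»), Cor. 7.14 (propagation to generizations), Prop. (prop:stab:smc) /
  Prop. 7.18 (stability under permissible transformations), Thm. 7.19 (combinatorial resolution lifts in the strong
  monomial case). -- TODO(general form): these four, once `ℛ_{𝒢,β}` / `𝓜_r W^s` are tree objects.

No named fact is introduced; nothing about H. Hironaka's 2017 manuscript is stated (the campaign consumes this file as
Literature, D-0089/D-0124); AI-written, weaker than expert review.
-/

noncomputable section

namespace Literature.AlgebraicGeometry.Resolution

namespace BV2013

open Polynomial IsLocalRing

universe u

variable {S : Type u} [CommRing S]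

section Defs

variable [IsLocalRing S]

/-- **Def. 7.10 (strong monomial case at a point), coefficient form**: with `t = ord(𝓜_r W^s)(β_r(x))` the order of
the tight monomial algebra at the point, the presentation `f` (parameter `ρ = ord((ℛ_{𝒢,β})_r)(β_r(x))`) is within
the STRONG MONOMIAL CASE at the point iff its H-ord (= `v-ord^{(d-1)}(𝒢_r)(x)`, Cor. 7.3) EQUALS `t`:
«`v-ord^{(d-1)}(𝒢_r)(x) = ord(𝓜_r W^s)(x)`». [cite: BenitoVillamayoru2013, Def. 7.10, arXiv chunk p0023 L22–L26] -/
def IsStrongMonomialAt (q : ℕ) (f : S[X]) (ρ t : ℚ) : Prop :=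
  IsHOrd q f ρ ((t : ℚ) : WithTop ℚ)

/-- Well-definedness read-out (Cor. 7.3: the H-ord is a well-defined rational number): if `v` is the H-ord of the
presentation, the strong monomial case holds iff `v = t`. [cite: BenitoVillamayoru2013, Cor. 7.3 and Def. 7.10, arXiv chunk p0022 L27–L33, p0023 L22–L26] -/
theorem isStrongMonomialAt_iff_eq {q : ℕ} {f : S[X]} {ρ t : ℚ} {v : WithTop ℚ} (hv : IsHOrd q f ρ v) :
    IsStrongMonomialAt q f ρ t ↔ v = ((t : ℚ) : WithTop ℚ) :=
  ⟨fun h => hv.unique h, fun h => by unfold IsStrongMonomialAt; rw [← h]; exact hv⟩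

/-- In the strong monomial case `t ≤ ρ` (the right half of the sandwich `ord(𝓜_r W^s) ≤ H-ord ≤ ord((ℛ_{𝒢,β})_r)`:
the H-ord never exceeds `ρ`). [cite: BenitoVillamayoru2013, §7.9 «the monomial 𝓜_r divides 𝒩_r», arXiv chunk p0023 L15–L20] -/
theorem IsStrongMonomialAt.le {q : ℕ} {f : S[X]} {ρ t : ℚ} (h : IsStrongMonomialAt q f ρ t) : t ≤ ρ := by
  have := IsHOrd.le_coe h
  exact_mod_cast this

/-- **Thm. 7.11, last sentence / condition (i), coefficient form**: when the elimination algebra IS the tight monomial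
algebra at the point (`ρ = t`), case A) of §5.1 for SOME change of section (`Sl = ord ℛ` is attained) puts the
presentation in the strong monomial case. [cite: BenitoVillamayoru2013, Thm. 7.11 (i) and its last sentence, arXiv chunk p0023 L30–L40] -/
theorem isStrongMonomialAt_of_isCaseA {q : ℕ} {f : S[X]} {ρ : ℚ} {α₀ : S} (hA : IsCaseA q (taylor α₀ f) ρ) :
    IsStrongMonomialAt q f ρ ρ :=
  isHOrd_of_isCaseA hA

end Defs

section Regular

variable [IsRegularLocalRing S]

/-- **Calibration (pure heads): the `δ_BV = 0` test.** For `f = z^{pᵉ} + a` over a local ring of characteristic `p`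
with `ν(a) = m`, `pᵉ ∤ m` and `m/pᵉ < ρ`, the H-ord is `m/pᵉ` (`isHOrd_X_pow_add_C_of_not_dvd`), so the point is in the
strong monomial case iff the tight monomial order there is `t = m/pᵉ`. [cite: BenitoVillamayoru2013, Def. 7.10 with §5.1 B1) / Def. 5.5 (1), arXiv chunk p0023 L22–L26] -/
theorem isStrongMonomialAt_X_pow_add_C_iff {p : ℕ} (hp : p.Prime) [CharP S p] (e : ℕ) {a : S} {m : ℕ}
    (ha : adicOrder a = (m : ℕ∞)) (hndvd : ¬ p ^ e ∣ m) {ρ : ℚ} (hρ : (m : ℚ) / (p ^ e : ℕ) < ρ) (t : ℚ) :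
    IsStrongMonomialAt (p ^ e) (X ^ (p ^ e) + C a : S[X]) ρ t ↔ t = (m : ℚ) / (p ^ e : ℕ) := by
  rw [isStrongMonomialAt_iff_eq (isHOrd_X_pow_add_C_of_not_dvd hp e ha hndvd hρ)]
  constructor
  · intro h; exact_mod_cast h.symm
  · intro h; exact_mod_cast h.symm

/-- The pure-head calibration in the strong direction: `t = m/pᵉ` ⇒ strong monomial case.
[cite: BenitoVillamayoru2013, Def. 7.10, arXiv chunk p0023 L22–L26] -/
theorem isStrongMonomialAt_X_pow_add_C {p : ℕ} (hp : p.Prime) [CharP S p] (e : ℕ) {a : S} {m : ℕ}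
    (ha : adicOrder a = (m : ℕ∞)) (hndvd : ¬ p ^ e ∣ m) {ρ : ℚ} (hρ : (m : ℚ) / (p ^ e : ℕ) < ρ) :
    IsStrongMonomialAt (p ^ e) (X ^ (p ^ e) + C a : S[X]) ρ ((m : ℚ) / (p ^ e : ℕ)) :=
  (isStrongMonomialAt_X_pow_add_C_iff hp e ha hndvd hρ _).mpr rfl

end Regular

end BV2013

end Literature.AlgebraicGeometry.Resolution

end
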